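import Summits.CriticalPhenomena.SAWScalingLimit.Theorems.SAWLeftRightFKGLeftRightFKGBoxLeafThreePoint
import Summits.CriticalPhenomena.SAWScalingLimit.Theorems.SAWLeftRightFKGLeftRightFKGBoxCornerMinor
import HarnessLib

/-!
# Crux `LeftRightFKG` (stmt-CriticalPhenomena-11232), line `corner-localisation` (lead c4, v9):
kernel bookkeeping on the NOTCHED box (`stub_notchThreePointOfIneq`, T9c)

GEOMETRY. The notched box: sites = open box `(x₀,x₁) × (y₀,y₁)` minus the bottom-row notch
`s = (x_s, y₀+1)`; the discrete domain graph `(dom C 1)_1` has lattice adjacency inside that set (hypothesis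
`hadj`, the conclusion of T9b `stub_notchedBoxWalk`; nothing else about `C` is used). Marked points
`a = (x_s-1, y₀+1)` (bottom row, left of the notch) and `b = (x_s, y₀+2)` (above the notch): a diagonal pair
whose common neighbours are `v = (x_s-1, y₀+2)` (in the domain) and `s` (NOT in the domain). Neighbours of `a`
in the domain: `W = (x_s-2, y₀+1)` and `v` (South is the wall, East is the notch; `nbr_a`); neighbours of `b`:
`v`, `E_b = (x_s+1, y₀+2)`, `N_b = (x_s, y₀+3)` (South is the notch; `nbr_b`). So the chords `a → b` are
partitioned by (first step, last step) `∈ {v, W} × {v, E_b, N_b}`, and the class dictionary at `k = m = 0`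
(`CornerLoc.stub_classDictionary`, two distinct chords `a v b` and `a W (x_s-2, y₀+2) v b`, `two_chords_notch`;
`CornerAssembly.sum_dirSet_eq`) identifies the entry `M(u', w')` of the end-step matrix with `x² · Z_G(u', w')`,
`Z_G = pathKernel G x` the self-avoiding path kernel of the free graph `G` (the domain graph with `a, b`
isolated), `Z_G(v, v) = 1` (the chord `a v b`).

BOOKKEEPING. With `R = Z_G(W,v)`, `Q = Z_G(v,E_b) + Z_G(v,N_b)`, `P = Z_G(W,E_b) + Z_G(W,N_b)` the events
`E = {first step = W}`, `F = {last step not from v}`, `univ`, `E ∩ F` weigh `x²(R + P)`, `x²(Q + P)`,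
`x²(1 + Q + R + P)`, `x² P` (`pointwise3`), so the ONE inequality `μ(E) μ(F) ≤ μ(univ) μ(E ∩ F)` (hypothesis)
reads, after cancelling `x⁴ > 0`, `R · Q ≤ P` — the registered conclusion, the three-point inequality at `v`
in `G`. Same carrier and bookkeeping as the landed `Families.stub_boxLeafThreePoint` (T5) and
`Families.stub_boxCornerMinor` (T8). Elementary given the landed stubs ("folklore").
-/

noncomputable section

open MeasureTheory SimpleGraph
open Literature.Probability.LatticeModels Literature.Probability.RandomPlanarGeometry
open Summit.CriticalPhenomena.SAWScalingLimit.Theorems.LeftRightFKG.Negative (bx pathCross wcross)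
open Summit.CriticalPhenomena.SAWScalingLimit.Theorems.LeftRightFKG.CornerLoc
open Summit.CriticalPhenomena.SAWScalingLimit.Theorems.BoundaryTP2 (pathKernel pathKernelOn)
open scoped Classical ENNReal

namespace Summit.CriticalPhenomena.SAWScalingLimit.Theorems.LeftRightFKG.Families

namespace NotchThreePoint

open BoxLeafThreePoint

/-- Explicit sites of the notched box: inside the open box and not the notch. [folklore] -/
theorem bx_mem_notched {x₀ x₁ y₀ y₁ x_s i j : ℤ}
    (h : ((x₀ < i ∧ i < x₁) ∧ (y₀ < j ∧ j < y₁)) ∧ (i ≠ x_s ∨ j ≠ y₀ + 1)) :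
    bx i j ∈ Negative.Rect.box x₀ x₁ y₀ y₁ \ {bx x_s (y₀ + 1)} :=
  ⟨h.1, fun h' => by
    rw [Set.mem_singleton_iff, bx_eq_iff] at h'
    omega⟩

/-- The lattice neighbours INSIDE THE NOTCHED BOX of the marked point `a = (x_s-1, y₀+1)` (bottom row, left
of the notch `s = (x_s, y₀+1)`) are `v = (x_s-1, y₀+2)` and `W = (x_s-2, y₀+1)`: South is the wall, East is
the notch. [folklore] -/
theorem nbr_a {x₀ x₁ y₀ y₁ x_s : ℤ} {a p : Site 2} (h : (zdGraph 2).Adj a p)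
    (hp : p ∈ Negative.Rect.box x₀ x₁ y₀ y₁ \ {bx x_s (y₀ + 1)}) (ha0 : a 0 = x_s - 1)
    (ha1 : a 1 = y₀ + 1) : p = bx (x_s - 1) (y₀ + 2) ∨ p = bx (x_s - 2) (y₀ + 1) := by
  have hcs := Negative.adj_cases h
  obtain ⟨⟨-, hp1, -⟩, hps⟩ := hp
  have hps' : ¬ (p 0 = x_s ∧ p 1 = y₀ + 1) := fun h' =>
    hps (by rw [Set.mem_singleton_iff, Negative.eq_bx p, bx_eq_iff]; exact h')
  rw [Negative.eq_bx p]
  simp only [bx_eq_iff]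
  omega

/-- The lattice neighbours INSIDE THE NOTCHED BOX of the marked point `b = (x_s, y₀+2)` (just above the
notch) are `v = (x_s-1, y₀+2)`, `E_b = (x_s+1, y₀+2)` and `N_b = (x_s, y₀+3)`: South is the notch. [folklore] -/
theorem nbr_b {x₀ x₁ y₀ y₁ x_s : ℤ} {b q : Site 2} (h : (zdGraph 2).Adj q b)
    (hq : q ∈ Negative.Rect.box x₀ x₁ y₀ y₁ \ {bx x_s (y₀ + 1)}) (hb0 : b 0 = x_s) (hb1 : b 1 = y₀ + 2) :
    q = bx (x_s - 1) (y₀ + 2) ∨ q = bx (x_s + 1) (y₀ + 2) ∨ q = bx x_s (y₀ + 3) := by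
  have hcs := Negative.adj_cases h
  obtain ⟨-, hqs⟩ := hq
  have hqs' : ¬ (q 0 = x_s ∧ q 1 = y₀ + 1) := fun h' =>
    hqs (by rw [Set.mem_singleton_iff, Negative.eq_bx q, bx_eq_iff]; exact h')
  rw [Negative.eq_bx q]
  simp only [bx_eq_iff]
  omega

/-- In the notched box (adjacency of `Ω_1` = lattice adjacency inside `box ∖ {s}`) there are two distinct
chords from `a = (x_s-1, y₀+1)` to `b = (x_s, y₀+2)`: `a v b` and `a W (x_s-2, y₀+2) v b` (they differ in
length). [folklore] -/
theorem two_chords_notch {Ω : Set ℂ} {x₀ x₁ y₀ y₁ x_s : ℤ}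
    (hadj : ∀ p q : Site 2, (discreteDomainGraph Ω 1).Adj p q ↔
      (zdGraph 2).Adj p q ∧ p ∈ Negative.Rect.box x₀ x₁ y₀ y₁ \ {bx x_s (y₀ + 1)} ∧
        q ∈ Negative.Rect.box x₀ x₁ y₀ y₁ \ {bx x_s (y₀ + 1)})
    (h₁ : x₀ + 2 < x_s) (h₂ : x_s < x₁) (h₃ : y₀ + 2 < y₁) {a b : Site 2}
    (ha : a = bx (x_s - 1) (y₀ + 1)) (hb : b = bx x_s (y₀ + 2)) :
    ∃ γ₁ γ₂ : SAW.DomainSAW Ω 1 a b, γ₁ ≠ γ₂ := by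
  subst ha hb
  have hA : ∀ {i₁ j₁ i₂ j₂ : ℤ},
      (((x₀ < i₁ ∧ i₁ < x₁) ∧ (y₀ < j₁ ∧ j₁ < y₁)) ∧ (i₁ ≠ x_s ∨ j₁ ≠ y₀ + 1)) →
      (((x₀ < i₂ ∧ i₂ < x₁) ∧ (y₀ < j₂ ∧ j₂ < y₁)) ∧ (i₂ ≠ x_s ∨ j₂ ≠ y₀ + 1)) →
      ((i₂ = i₁ + 1 ∧ j₂ = j₁) ∨ (i₁ = i₂ + 1 ∧ j₂ = j₁) ∨ (j₂ = j₁ + 1 ∧ i₂ = i₁) ∨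
        (j₁ = j₂ + 1 ∧ i₂ = i₁)) →
      (discreteDomainGraph Ω 1).Adj (bx i₁ j₁) (bx i₂ j₂) := fun h1 h2 h =>
    (hadj _ _).2 ⟨Negative.adj_bx _ _ _ _ h, bx_mem_notched h1, bx_mem_notched h2⟩
  refine ⟨⟨Walk.cons (hA (i₂ := x_s - 1) (j₂ := y₀ + 2) (by omega) (by omega) (by omega))
      (Walk.cons (hA (i₂ := x_s) (j₂ := y₀ + 2) (by omega) (by omega) (by omega)) Walk.nil),
      Walk.IsPath.mk' ?_⟩,
    ⟨Walk.cons (hA (i₂ := x_s - 2) (j₂ := y₀ + 1) (by omega) (by omega) (by omega))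
      (Walk.cons (hA (i₂ := x_s - 2) (j₂ := y₀ + 2) (by omega) (by omega) (by omega))
        (Walk.cons (hA (i₂ := x_s - 1) (j₂ := y₀ + 2) (by omega) (by omega) (by omega))
          (Walk.cons (hA (i₂ := x_s) (j₂ := y₀ + 2) (by omega) (by omega) (by omega)) Walk.nil))),
      Walk.IsPath.mk' ?_⟩,
    fun h => ?_⟩
  · simp [bx_eq_iff]
  · simp [bx_eq_iff]
  · have hl := congrArg SAW.DomainSAW.length h
    simp [SAW.DomainSAW.length] at hl

/-- POINTWISE BOOKKEEPING: for a chord with first step `r ∈ {v, W}` and last step `s ∈ {v, E_b, N_b}`, the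
indicators of `E = {r = W}`, `F = {s ≠ v}`, `univ`, `E ∩ F` are the sums of the indicators of the end-step
classes they contain. [folklore] -/
theorem pointwise3 {α : Type*} [DecidableEq α] (f : ℝ) {r s v W eb nb : α} (hr : r = v ∨ r = W)
    (hs : s = v ∨ s = eb ∨ s = nb) (hvW : v ≠ W) (hve : v ≠ eb) (hvn : v ≠ nb) (hen : eb ≠ nb) :
    ((if r = W then f else 0) =
      (if r = W ∧ s = v then f else 0) + (if r = W ∧ s = eb then f else 0) +
        (if r = W ∧ s = nb then f else 0)) ∧
    ((if s ≠ v then f else 0) =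
      (if r = v ∧ s = eb then f else 0) + (if r = v ∧ s = nb then f else 0) +
        (if r = W ∧ s = eb then f else 0) + (if r = W ∧ s = nb then f else 0)) ∧
    (f = (if r = v ∧ s = v then f else 0) + (if r = v ∧ s = eb then f else 0) +
      (if r = v ∧ s = nb then f else 0) + (if r = W ∧ s = v then f else 0) +
      (if r = W ∧ s = eb then f else 0) + (if r = W ∧ s = nb then f else 0)) ∧
    ((if r = W ∧ s ≠ v then f else 0) =
      (if r = W ∧ s = eb then f else 0) + (if r = W ∧ s = nb then f else 0)) := by
  rcases hr with rfl | rfl <;> rcases hs with rfl | rfl | rfl <;>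
    simp [hvW, hvW.symm, hve, hve.symm, hvn, hvn.symm, hen, hen.symm]

end NotchThreePoint

open BoxLeafThreePoint NotchThreePoint in
/-- STUB T9c `stub_notchThreePointOfIneq` of line `corner-localisation` (crux `LeftRightFKG`,
stmt-CriticalPhenomena-11232): KERNEL BOOKKEEPING on the notched box. For any closed walk `C` whose discrete
domain (`δ = 1`) has lattice adjacency inside `box ∖ {s}`, `s = (x_s, y₀+1)` (T9b's conclusion as hypothesis),
any fugacity `0 < x`, and the marked diagonal pair `a = (x_s-1, y₀+1)`, `b = (x_s, y₀+2)`: the ONE inequality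
`μ(E) μ(F) ≤ μ(univ) μ(E ∩ F)` of the fugacity-`x` chord measure for `E = {first step West}`,
`F = {last step not from v}` implies (class dictionary at `k = m = 0`, `Z_G(v,v) = 1`, cancelling `x⁴`) the
three-point inequality at `v = (x_s-1, y₀+2)` in the free graph `G`:
`Z_G(W,v) · (Z_G(v,E_b) + Z_G(v,N_b)) ≤ Z_G(W,E_b) + Z_G(W,N_b)`, `W = (x_s-2, y₀+1)`, `E_b = (x_s+1, y₀+2)`,
`N_b = (x_s, y₀+3)`, `Z_G = pathKernel G x`. [folklore] -/
theorem stub_notchThreePointOfIneq : ∀ (x : ℝ) (x₀ x₁ y₀ y₁ x_s : ℤ)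
    (C : (zdGraph 2).Walk (bx x₀ y₀) (bx x₀ y₀)),
    0 < x → x₀ + 2 < x_s → x_s + 1 < x₁ → y₀ + 3 < y₁ →
    (∀ u w : Site 2, (discreteDomainGraph (dom C 1) 1).Adj u w ↔
      (zdGraph 2).Adj u w ∧ u ∈ Negative.Rect.box x₀ x₁ y₀ y₁ \ {bx x_s (y₀ + 1)} ∧
        w ∈ Negative.Rect.box x₀ x₁ y₀ y₁ \ {bx x_s (y₀ + 1)}) →
    μx x (dom C 1) 1 (bx (x_s - 1) (y₀ + 1)) (bx x_s (y₀ + 2))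
        {γ | γ.walk.getVert 1 = bx (x_s - 2) (y₀ + 1)} *
      μx x (dom C 1) 1 (bx (x_s - 1) (y₀ + 1)) (bx x_s (y₀ + 2))
        {γ | γ.walk.reverse.getVert 1 ≠ bx (x_s - 1) (y₀ + 2)} ≤
    μx x (dom C 1) 1 (bx (x_s - 1) (y₀ + 1)) (bx x_s (y₀ + 2)) Set.univ *
      μx x (dom C 1) 1 (bx (x_s - 1) (y₀ + 1)) (bx x_s (y₀ + 2))
        ({γ | γ.walk.getVert 1 = bx (x_s - 2) (y₀ + 1)} ∩
          {γ | γ.walk.reverse.getVert 1 ≠ bx (x_s - 1) (y₀ + 2)}) →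
    ∀ G : SimpleGraph (Site 2),
      G = freeGraph (dom C 1) 1 0 (fun _ => bx (x_s - 1) (y₀ + 1)) 0 (fun _ => bx x_s (y₀ + 2)) →
      pathKernel G x (bx (x_s - 2) (y₀ + 1)) (bx (x_s - 1) (y₀ + 2)) *
          (pathKernel G x (bx (x_s - 1) (y₀ + 2)) (bx (x_s + 1) (y₀ + 2)) +
            pathKernel G x (bx (x_s - 1) (y₀ + 2)) (bx x_s (y₀ + 3))) ≤
        pathKernel G x (bx (x_s - 2) (y₀ + 1)) (bx (x_s + 1) (y₀ + 2)) +
          pathKernel G x (bx (x_s - 2) (y₀ + 1)) (bx x_s (y₀ + 3)) := by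
  intro x x₀ x₁ y₀ y₁ x_s C hx0 h₁ h₂ h₃ hadj key G hG
  -- names and coordinates of the six sites
  obtain ⟨a, ha⟩ : ∃ a : Site 2, a = bx (x_s - 1) (y₀ + 1) := ⟨_, rfl⟩
  obtain ⟨b, hb⟩ : ∃ b : Site 2, b = bx x_s (y₀ + 2) := ⟨_, rfl⟩
  obtain ⟨v, hv⟩ : ∃ v : Site 2, v = bx (x_s - 1) (y₀ + 2) := ⟨_, rfl⟩
  obtain ⟨W, hW⟩ : ∃ W : Site 2, W = bx (x_s - 2) (y₀ + 1) := ⟨_, rfl⟩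
  obtain ⟨eb, heb⟩ : ∃ eb : Site 2, eb = bx (x_s + 1) (y₀ + 2) := ⟨_, rfl⟩
  obtain ⟨nb, hnb⟩ : ∃ nb : Site 2, nb = bx x_s (y₀ + 3) := ⟨_, rfl⟩
  rw [← ha, ← hb] at hG key
  rw [← hv, ← hW] at key
  rw [← hv, ← hW, ← heb, ← hnb]
  obtain ⟨ha0, ha1⟩ : a 0 = x_s - 1 ∧ a 1 = y₀ + 1 := by subst ha; exact ⟨rfl, rfl⟩
  obtain ⟨hb0, hb1⟩ : b 0 = x_s ∧ b 1 = y₀ + 2 := by subst hb; exact ⟨rfl, rfl⟩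
  obtain ⟨hv0, hv1⟩ : v 0 = x_s - 1 ∧ v 1 = y₀ + 2 := by subst hv; exact ⟨rfl, rfl⟩
  obtain ⟨hW0, hW1⟩ : W 0 = x_s - 2 ∧ W 1 = y₀ + 1 := by subst hW; exact ⟨rfl, rfl⟩
  obtain ⟨heb0, heb1⟩ : eb 0 = x_s + 1 ∧ eb 1 = y₀ + 2 := by subst heb; exact ⟨rfl, rfl⟩
  obtain ⟨hnb0, hnb1⟩ : nb 0 = x_s ∧ nb 1 = y₀ + 3 := by subst hnb; exact ⟨rfl, rfl⟩
  obtain ⟨hvW, hve, hvn, hen, hab⟩ : v ≠ W ∧ v ≠ eb ∧ v ≠ nb ∧ eb ≠ nb ∧ a ≠ b :=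
    ⟨site_ne (Or.inl (by omega)), site_ne (Or.inl (by omega)), site_ne (Or.inl (by omega)),
      site_ne (Or.inl (by omega)), site_ne (Or.inl (by omega))⟩
  obtain ⟨hva, hvb, hWa, hWb, hea, hebb, hna, hnbb⟩ :
      v ≠ a ∧ v ≠ b ∧ W ≠ a ∧ W ≠ b ∧ eb ≠ a ∧ eb ≠ b ∧ nb ≠ a ∧ nb ≠ b :=
    ⟨site_ne (Or.inr (by omega)), site_ne (Or.inl (by omega)), site_ne (Or.inl (by omega)),
      site_ne (Or.inl (by omega)), site_ne (Or.inl (by omega)), site_ne (Or.inl (by omega)),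
      site_ne (Or.inr (by omega)), site_ne (Or.inr (by omega))⟩
  -- memberships in the notched box and adjacencies in `Ω_1` of the named sites
  have hmem : ∀ p : Site 2,
      ((x₀ < p 0 ∧ p 0 < x₁) ∧ (y₀ < p 1 ∧ p 1 < y₁)) ∧ (p 0 ≠ x_s ∨ p 1 ≠ y₀ + 1) →
      p ∈ Negative.Rect.box x₀ x₁ y₀ y₁ \ {bx x_s (y₀ + 1)} := fun p hp => by
    rw [Negative.eq_bx p]
    exact bx_mem_notched hp
  obtain ⟨habox, hbbox, hvbox, hWbox, hebox, hnbox⟩ :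
      a ∈ Negative.Rect.box x₀ x₁ y₀ y₁ \ {bx x_s (y₀ + 1)} ∧
      b ∈ Negative.Rect.box x₀ x₁ y₀ y₁ \ {bx x_s (y₀ + 1)} ∧
      v ∈ Negative.Rect.box x₀ x₁ y₀ y₁ \ {bx x_s (y₀ + 1)} ∧
      W ∈ Negative.Rect.box x₀ x₁ y₀ y₁ \ {bx x_s (y₀ + 1)} ∧
      eb ∈ Negative.Rect.box x₀ x₁ y₀ y₁ \ {bx x_s (y₀ + 1)} ∧
      nb ∈ Negative.Rect.box x₀ x₁ y₀ y₁ \ {bx x_s (y₀ + 1)} :=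
    ⟨hmem a (by omega), hmem b (by omega), hmem v (by omega), hmem W (by omega), hmem eb (by omega),
      hmem nb (by omega)⟩
  have hDav : (discreteDomainGraph (dom C 1) 1).Adj a v :=
    (hadj a v).2 ⟨by rw [ha, hv]; exact Negative.adj_bx _ _ _ _ (by omega), habox, hvbox⟩
  have hDaW : (discreteDomainGraph (dom C 1) 1).Adj a W :=
    (hadj a W).2 ⟨by rw [ha, hW]; exact Negative.adj_bx _ _ _ _ (by omega), habox, hWbox⟩
  have hDvb : (discreteDomainGraph (dom C 1) 1).Adj v b :=
    (hadj v b).2 ⟨by rw [hv, hb]; exact Negative.adj_bx _ _ _ _ (by omega), hvbox, hbbox⟩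
  have hDeb : (discreteDomainGraph (dom C 1) 1).Adj eb b :=
    (hadj eb b).2 ⟨by rw [heb, hb]; exact Negative.adj_bx _ _ _ _ (by omega), hebox, hbbox⟩
  have hDnb : (discreteDomainGraph (dom C 1) 1).Adj nb b :=
    (hadj nb b).2 ⟨by rw [hnb, hb]; exact Negative.adj_bx _ _ _ _ (by omega), hnbox, hbbox⟩
  clear hmem hvbox hWbox hebox hnbox
  -- chords: finiteness, first and last steps
  haveI : Finite (SAW.DomainSAW (dom C 1) 1 a b) := finite_domainSAW C one_pos
  haveI : Fintype (SAW.DomainSAW (dom C 1) 1 a b) := Fintype.ofFinite _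
  have hlen : ∀ γ : SAW.DomainSAW (dom C 1) 1 a b, 0 < γ.walk.length := fun γ =>
    Nat.pos_of_ne_zero fun h0 => hab (γ.walk.eq_of_length_eq_zero h0)
  have hadj1 : ∀ γ : SAW.DomainSAW (dom C 1) 1 a b,
      (discreteDomainGraph (dom C 1) 1).Adj a (γ.walk.getVert 1) := fun γ => by
    have h := γ.walk.adj_getVert_succ (hlen γ)
    rwa [Walk.getVert_zero] at h
  have hadj1R : ∀ γ : SAW.DomainSAW (dom C 1) 1 a b,
      (discreteDomainGraph (dom C 1) 1).Adj (γ.walk.reverse.getVert 1) b := fun γ => by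
    have h := γ.walk.reverse.adj_getVert_succ (i := 0) (by rw [Walk.length_reverse]; exact hlen γ)
    rw [Walk.getVert_zero] at h
    exact h.symm
  have hU : ∀ γ : SAW.DomainSAW (dom C 1) 1 a b,
      γ.walk.getVert 1 = v ∨ γ.walk.getVert 1 = W := fun γ => by
    obtain ⟨hl, -, hp⟩ := (hadj _ _).1 (hadj1 γ)
    have h' := nbr_a hl hp ha0 ha1
    rwa [← hv, ← hW] at h'
  have hWl : ∀ γ : SAW.DomainSAW (dom C 1) 1 a b, γ.walk.reverse.getVert 1 = v ∨
      γ.walk.reverse.getVert 1 = eb ∨ γ.walk.reverse.getVert 1 = nb := fun γ => by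
    obtain ⟨hl, hq, -⟩ := (hadj _ _).1 (hadj1R γ)
    have h' := nbr_b hl hq hb0 hb1
    rwa [← hv, ← heb, ← hnb] at h'
  -- the hypothesis as a real inequality between products of sums over end-step classes
  have hμ := fun S : Set (SAW.DomainSAW (dom C 1) 1 a b) => μx_apply_eq_ofReal hx0.le S
  simp only [hμ] at key
  rw [← ENNReal.ofReal_mul (Finset.sum_nonneg fun γ _ => pow_nonneg hx0.le _),
    ← ENNReal.ofReal_mul (Finset.sum_nonneg fun γ _ => pow_nonneg hx0.le _),
    ENNReal.ofReal_le_ofReal_iff (mul_nonneg (Finset.sum_nonneg fun γ _ => pow_nonneg hx0.le _)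
      (Finset.sum_nonneg fun γ _ => pow_nonneg hx0.le _))] at key
  simp only [Finset.sum_filter, Set.mem_setOf_eq, Set.mem_inter_iff, Set.mem_univ, if_true] at key
  -- the end-step matrix `M`, the kernels `Z` of the free graph; the four sums in terms of the six entries
  obtain ⟨M, hM⟩ : ∃ M : Site 2 → Site 2 → ℝ, ∀ p q, M p q =
      ∑ γ : SAW.DomainSAW (dom C 1) 1 a b,
        if γ.walk.getVert 1 = p ∧ γ.walk.reverse.getVert 1 = q then x ^ γ.length else 0 :=
    ⟨_, fun _ _ => rfl⟩
  obtain ⟨Z, hZ⟩ : ∃ Z : Site 2 → Site 2 → ℝ, ∀ p q, Z p q = (pathKernel G x p q).toReal :=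
    ⟨_, fun _ _ => rfl⟩
  have hpw := fun γ : SAW.DomainSAW (dom C 1) 1 a b =>
    pointwise3 (x ^ γ.length) (hU γ) (hWl γ) hvW hve hvn hen
  rw [Fintype.sum_congr _ _ fun γ => (hpw γ).1, Fintype.sum_congr _ _ fun γ => (hpw γ).2.1,
    Fintype.sum_congr _ _ fun γ => (hpw γ).2.2.1, Fintype.sum_congr _ _ fun γ => (hpw γ).2.2.2] at key
  simp only [Finset.sum_add_distrib, ← hM] at key
  have ineq : M W v * (M v eb + M v nb) ≤ M v v * (M W eb + M W nb) := by nlinarith [key]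
  clear key hpw hU hWl hadj1 hadj1R hlen
  -- the class dictionary at `k = m = 0`: entries are `x²` times kernels of the free graph
  have hGfin' : (freeGraph (dom C 1) 1 0 (fun _ => a) 0 (fun _ => b)).support.Finite :=
    support_freeGraph_finite (isBounded_dom C 1) one_pos 0 _ 0 _
  have hGfin : G.support.Finite := by rw [hG]; exact hGfin'
  have hfix : ∀ p : Site 2, p ≠ a → p ≠ b → p ∉ fixedSet 0 (fun _ : ℕ => a) 0 (fun _ : ℕ => b) := by
    rintro p hpa hpb (⟨_, _, h⟩ | ⟨_, _, h⟩)
    exacts [hpa h.symm, hpb h.symm]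
  have h2 : ∃ γ₁ γ₂ : SAW.DomainSAW (dom C 1) 1 a b, γ₁ ∈ cls 0 (fun _ => a) 0 (fun _ => b) ∧
      γ₂ ∈ cls 0 (fun _ => a) 0 (fun _ => b) ∧ γ₁ ≠ γ₂ := by
    obtain ⟨γ₁, γ₂, h12⟩ := two_chords_notch hadj h₁ (by omega) (by omega) ha hb
    exact ⟨γ₁, γ₂, by rw [cls_zero]; exact Set.mem_univ _, by rw [cls_zero]; exact Set.mem_univ _, h12⟩
  have hdict : ∀ p q : Site 2, p ≠ a → p ≠ b → q ≠ a → q ≠ b →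
      (discreteDomainGraph (dom C 1) 1).Adj a p → (discreteDomainGraph (dom C 1) 1).Adj q b →
      M p q = x ^ 2 * Z p q := by
    intro p q hpa hpb hqa hqb hap hqb'
    have hkey := CornerAssembly.sum_dirSet_eq (k := 0) (π := fun _ => a) (m := 0) (σ := fun _ => b)
      (stub_classDictionary (dom C 1) 1 a b) h2 hGfin' hx0.le (hfix p hpa hpb) (hfix q hqa hqb) hap hqb'
    simp only [zero_add] at hkey
    rw [hM, hZ, hG, ← hkey, Finset.sum_filter]
    exact Finset.sum_congr rfl fun γ _ =>
      if_congr (by simp only [mem_dirSet, cls_zero, Set.mem_univ, true_and, zero_add]) rfl rfl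
  have vvv := hdict v v hva hvb hva hvb hDav hDvb
  have vve := hdict v eb hva hvb hea hebb hDav hDeb
  have vvn := hdict v nb hva hvb hna hnbb hDav hDnb
  have vWv := hdict W v hWa hWb hva hvb hDaW hDvb
  have vWe := hdict W eb hWa hWb hea hebb hDaW hDeb
  have vWn := hdict W nb hWa hWb hna hnbb hDaW hDnb
  have hZvv : Z v v = 1 := by rw [hZ, BoundaryTP2.pathKernel_self, ENNReal.toReal_one]
  rw [vvv, vve, vvn, vWv, vWe, vWn, hZvv] at ineq
  -- cancel `x ^ 4` and return to `ℝ≥0∞`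
  have hZ0 : ∀ p q, 0 ≤ Z p q := fun p q => by rw [hZ]; exact ENNReal.toReal_nonneg
  have real_ineq : Z W v * (Z v eb + Z v nb) ≤ Z W eb + Z W nb := by
    refine le_of_mul_le_mul_left ?_ (pow_pos hx0 4)
    nlinarith [ineq]
  have hK : ∀ p q, pathKernel G x p q = ENNReal.ofReal (Z p q) := fun p q => by
    rw [hZ, ENNReal.ofReal_toReal (BoundaryTP2.pathKernel_ne_top hGfin x p q)]
  rw [hK W v, hK v eb, hK v nb, hK W eb, hK W nb, ← ENNReal.ofReal_add (hZ0 v eb) (hZ0 v nb),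
    ← ENNReal.ofReal_mul (hZ0 W v), ← ENNReal.ofReal_add (hZ0 W eb) (hZ0 W nb)]
  exact ENNReal.ofReal_le_ofReal real_ineq

end Summit.CriticalPhenomena.SAWScalingLimit.Theorems.LeftRightFKG.Families

end
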